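import Summits.BirchSwinnertonDyer.BirchSwinnertonDyer.Theorems.RamifiedHeegnerPairRamifiedPairUpperBoundOfUpperHalfOverK
import Summits.BirchSwinnertonDyer.BirchSwinnertonDyer.Theorems.SchneiderFreeAdditiveX3JointUpperManin
import Summits.BirchSwinnertonDyer.BirchSwinnertonDyer.Theorems.WildThreeRankOneBSDpOfGlobalDivisibility
import Literature.NumberTheory.EllipticCurves.PerrinRiou2003.RankZeroSupersingularUpperBound
import Literature.NumberTheory.QuadraticFields.ImaginaryResiduePiForm
import HarnessLib

/-!
# Route `RamifiedHeegnerPair`, crux X2 `RamifiedPairUpperBound` (stmt-BirchSwinnertonDyer-23192) — the rank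
# orientation `(r_an(E), r_an(E^{(d)})) = (1, 0)`: the good supersingular member from print (Perrin-Riou 2003
# Prop. 4.8), and the additive rank-ONE member through the cell's Kolyvagin-side socket over a SPLIT Heegner field

HONEST FRAMING. Theorems only; helper file (`--supports stmt-BirchSwinnertonDyer-23192`); nothing is booked,
no item is closed, BSD is not proved for any curve. The crux X2 — `ord₃ #Ш(E) + ord₃ #Ш(V) ≤ ord₃ #Ш_an(E) +
ord₃ #Ш_an(V)` for every 3-ramified twist pair `(E, V ≅ E^{(d)})` on the W-ALL leaf Gss2 at `3` — is, pair by
pair, LITERALLY the cell's joint upper half `SchneiderFree.Upper.JointUpperBoundAt W V 3`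
(`ramifiedPairUpperBound_iff_forall_jointUpperBoundAt`, by `Iff.rfl`). The companion file
`RamifiedHeegnerPairRamifiedPairUpperBoundRankZeroMember.lean` (lead g0) did the orientation `(0, 1)` from
print on the Kato-sharp rows. This file does the orientation **(1, 0)** — `r_an(E) = 1`, `E` additive
potentially supersingular at `3`; `r_an(V) = 0`, `V` GOOD supersingular at `3`:

* §1 `jointUpperBoundAt_of_analyticRank_eq_one_of_upperW_of_prop48` — the good member `V` in analytic rank
  `0` gets its half from PRINT: Perrin-Riou 2003 Prop. 4.8 (Kato) at a good supersingular `3`, `a_3`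
  arbitrary, any conductor, under Kato's (12.5.2) = `surj(9)` (`PerrinRiou2003.missingUpperBoundAt_three_of_
  prop48_of_nine`). So X2 at `(W, V, d)` in this orientation is EXACTLY the rank-one member's
  `Typed.MissingUpperBoundAt W 3` plus print.
* §2 `missingUpperBoundAt_three_of_rankOne_addv_of_upperSocket_of_twistLower` — the rank-one member's half
  in the CELL'S COMMON CURRENCY, over a SPLIT Heegner field `K′` (3 split, all of `N_E` split; NOT the
  route's ramified `ℚ(√d)`): the Kolyvagin-side socket `SchneiderFree.Upper.IndexUpperBoundLeAt W 3 K′ P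
  (v₃ c)` (co-STEP L: `ord₃ #Ш(E/K′) + 2·ord₃ ∏_ℓ c_ℓ(E) + 2 v₃(c) ≤ 2·ord₃ [E(K′):ℤP]`, Tamagawa-EXACT by
  design) + the LOWER half `Typed.MissingLowerBoundAt Wd 3` of the rank-ZERO twist `Wd ≅ E^{(d_{K′})}`
  (again a Gss2 curve: `d_{K′}` is prime to `3`) ⟹ `Typed.MissingUpperBoundAt W 3` (the cell's landed
  `jointUpperBoundAt_of_coStepL_manin` + `missingUpperBoundAt_of_jointUpper_of_lower`, Theses-free).
* §3 `missingUpperBoundAt_three_of_rankOne_addv_tamFree_of_kolyvagin_of_twistLower` — on the TAM-FREE rows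
  (`3 ∤ ∏_ℓ c_ℓ(E)`, `ρ̄_{E,3}` onto, a parametrisation with `3 ∤ c`) the socket IS PRINT: Kolyvagin 1990
  Thm. A / McCallum 1991 §1 (`Kolyvagin1990_padicValNat_card_sha_le`, `p` odd, `ρ̄` onto, NO clause at `p`;
  the cell's `SchneiderFree.Exact.upper_zero_of_kolyvagin_of_not_dvd_tamagawa`), so the rank-one member's
  upper half is PRINT + the twist's rank-zero LOWER half.
* §4 the assembled pair statements `jointUpperBoundAt_rankOne_of_upperSocket_of_twistLower_of_prop48` and
  `jointUpperBoundAt_rankOne_tamFree_of_print_of_twistLower` — X2's conclusion AT `(W, V, d)` in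
  orientation (1, 0).
* §5 `ramifiedPairUpperBound_of_rankSplit_missingUpperBoundAt` — X2 BY NAME from three member statements
  over `ℚ` (leaf `r_an = 1`, leaf `r_an = 0`, good-supersingular partner), refining door (ii) of
  `RamifiedHeegnerPairRamifiedPairUpperBoundOfUpperHalfOverK.lean` by analytic rank.

WHAT THIS SAYS ABOUT THE LINE (lead's reading, for the planner; numbers = census
`pub/bsd-wall/bsd-wall-census/blockA/BLOCK-A-index.json`, READ 2026-08-28): for the UPPER half Kolyvagin
needs no hypothesis at `p` (c₃(E) ∈ {1,2,4} on Gss2 is a 3-unit), so a SPLIT `K′` gives the same index bound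
as the thesis's ramified `K = ℚ(√d)` with PRINTED objects; in either field the bound is Tamagawa-exact only
through `2·ord₃ ∏_ℓ c_ℓ(E)` — of the 355 residual rank-one Gss2 classes, 9 are tam-free (§3 applies: print +
the twist's lower half), 106 carry one Tamagawa `3` (Jetchev's `max`-form, printed for `p ∤ N` only), 240
carry ≥ 2 (Jetchev Conj. 1.3 Σ-form = the tree's `AdditiveThree.RKC3Divisibility`, unproved). The
3-ramified field is load-bearing for X1 (signed/IMC side), not for X2.

References: [cite: PerrinRiou2003, Prop. 4.8 (p. 162)] [cite: Kato2004Asterisque, (12.5.2) (p. 222)]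
[cite: McCallumLMS1991, §1 Theorem (Kolyvagin), p. 296] [cite: GrossZagier1986, Thm. I.(6.3), I.(7.3)]
[cite: JetchevSkinnerWan2017, §7.4.1 (arXiv:1512.06894 p. 30)] [cite: Jetchev2008, Conj. 1.3, Thm. 1.4, Cor. 1.5]
[cite: Miller2011LMS, §1 and Def. 1.1]. Lead prover bsd-line-rhp-p2 g2, 2026-08-28.
-/

-- D-0017: single-problem summit, so `Summit.BirchSwinnertonDyer.BirchSwinnertonDyer.…` repeats a namespace BY DESIGN.
set_option linter.dupNamespace false
set_option autoImplicit false

noncomputable section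

open scoped Classical

open WeierstrassCurve NumberField Literature.NumberTheory.EllipticCurves
  Literature.NumberTheory.EllipticCurves.ModularForms Literature.NumberTheory.EllipticCurves.Rank1Residual
  Literature.NumberTheory.EllipticCurves.Rank1Residual.Typed Literature.NumberTheory.EllipticCurves.KrizLi2019
  Summit.BirchSwinnertonDyer.Rank1Residual Summit.BirchSwinnertonDyer.Rank1Residual.Additive
  Summit.BirchSwinnertonDyer.Rank1Residual.X11b
  Summit.BirchSwinnertonDyer.BirchSwinnertonDyer.Theorems.SchneiderFree

namespace Summit.BirchSwinnertonDyer.BirchSwinnertonDyer.Theorems.RamifiedPairUpperBound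

/-! ## §0 The crux in the cell's currency -/

/-- **X2 by name is the cell's JOINT upper half over the 3-ramified pair, pair by pair** (definitional
unfolding: `RamifiedPairUpperBound` ⟺ `∀ (W, V, d)` admissible, `SchneiderFree.Upper.JointUpperBoundAt W V 3`).
[cite: Miller2011LMS, §1 and Def. 1.1 (arXiv:1010.2431 p. 3)] -/
theorem ramifiedPairUpperBound_iff_forall_jointUpperBoundAt :
    Summit.BirchSwinnertonDyer.BirchSwinnertonDyer.Theses.RamifiedHeegnerPair.RamifiedPairUpperBound ↔
      ∀ (W : WeierstrassCurve ℚ) [W.IsElliptic] [W.IsGloballyMinimal]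
        (V : WeierstrassCurve ℚ) [V.IsElliptic] [V.IsGloballyMinimal] (d : ℤ),
        ¬ W.HasCM → Addv W 3 → SubGss W 3 → d < 0 → padicValInt 3 d = 1 → Squarefree d →
        (∃ C : WeierstrassCurve.VariableChange ℚ, C • W.quadraticTwist (d : ℚ) = V) → GoodSS V 3 →
        W.analyticRank + V.analyticRank = 1 → Upper.JointUpperBoundAt W V 3 :=
  Iff.rfl

/-! ## §1 Orientation (1, 0): the good supersingular rank-zero member from print -/

/-- **Orientation (1, 0), the good member from PRINT.** GIVEN Perrin-Riou 2003 Prop. 4.8 (Kato; `hPR`),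
Gross–Zagier–Kolyvagin (`hGZK`) and modularity (`hmod`): for `W` with `r_an(W) = 1` and `V` good supersingular
at `3` with `r_an(W) + r_an(V) = 1` (so `r_an(V) = 0`) and `surj(9)` for `V` (= Kato's (12.5.2) at `3`), the
joint upper half `JointUpperBoundAt W V 3` — i.e. the conclusion of `RamifiedPairUpperBound` at `(W, V, d)` —
follows from the rank-ONE member's `Typed.MissingUpperBoundAt W 3` ALONE. [cite: PerrinRiou2003, Prop. 4.8 (p. 162)]
[cite: Kato2004Asterisque, (12.5.2) in Thm. 12.5 (4) (p. 222)] [cite: Miller2011LMS, Def. 1.1] -/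
theorem jointUpperBoundAt_of_analyticRank_eq_one_of_upperW_of_prop48
    (hPR : PerrinRiou2003.prop48_padicValRat_bsd_rank_zero_le)
    (hGZK : rank_eq_analyticRank_of_analyticRank_le_one) (hmod : hasEntireLFunction_rat)
    (W : WeierstrassCurve ℚ) [W.IsElliptic] [W.IsGloballyMinimal]
    (V : WeierstrassCurve ℚ) [V.IsElliptic] [V.IsGloballyMinimal]
    (hss : GoodSS V 3) (hsum : W.analyticRank + V.analyticRank = 1) (hr1 : W.analyticRank = 1)
    (h9 : V.HasSurjectiveModNGaloisRep 9) (hUW : MissingUpperBoundAt W 3) :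
    Upper.JointUpperBoundAt W V 3 := by
  have hrV : V.analyticRank = 0 := by omega
  obtain ⟨q, hq, hleW⟩ := hUW
  obtain ⟨q', hq', hleV⟩ :=
    PerrinRiou2003.missingUpperBoundAt_three_of_prop48_of_nine V hPR hGZK hmod hss h9 hrV
  exact ⟨q, q', hq, hq', by linarith⟩

/-! ## §2 The rank-one additive member through the Kolyvagin-side socket over a SPLIT Heegner field -/

/-- **The rank-ONE member's upper half from co-STEP L over a SPLIT Heegner field and the twist's rank-zero
LOWER half** (cell currency; Theses-free inputs). Data: `W/ℚ` globally minimal, ADDITIVE at `3`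
(`Addv W 3`, so `3 ∣ N_E`), `r_an(W) = 1`; a Heegner datum over an imaginary quadratic `K′` of ODD discriminant
`d_{K′} < −4` satisfying the CLASSICAL Heegner hypothesis for `N = N_E` (every prime of `N_E`, in particular
`3`, SPLIT), `L(E^{(d_{K′})}, 1) ≠ 0`, the Heegner point `P` of `(Dt, H, ι)`, a globally minimal model `Wd`
of the twist; PUBLISHED binders `hGZ`, `hKo`, `hGZK`, `hmod`, `hGZ73`. INPUTS: the Kolyvagin-side socket
`IndexUpperBoundLeAt W 3 K′ P (v₃ c)` (`ord₃ #Ш(E/K′) + 2·ord₃ ∏_ℓ c_ℓ(E) + 2v₃(c) ≤ 2·ord₃[E(K′):ℤP]`) and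
`Typed.MissingLowerBoundAt Wd 3`. OUTPUT: `Typed.MissingUpperBoundAt W 3`. (`jointUpperBoundAt_of_coStepL_manin`
then `missingUpperBoundAt_of_jointUpper_of_lower`; `#𝓞_{K′}^× = 2` from `d_{K′} < −4`.)
[cite: GrossZagier1986, Thm. I.(6.3) and (7.3)] [cite: JetchevSkinnerWan2017, §7.4.1 (arXiv:1512.06894 p. 30)]
[cite: Miller2011LMS, Def. 1.1] -/
theorem missingUpperBoundAt_three_of_rankOne_addv_of_upperSocket_of_twistLower
    (hGZ : ∀ (N : ℕ) [NeZero N] (W : WeierstrassCurve ℚ) (K : Type) [Field K] [NumberField K],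
      gross_zagier N W K)
    (hKo : ∀ (N : ℕ) [NeZero N] (W : WeierstrassCurve ℚ) (K : Type) [Field K] [NumberField K],
      kolyvagin N W K)
    (hGZK : rank_eq_analyticRank_of_analyticRank_le_one) (hmod : hasEntireLFunction_rat)
    (hGZ73 : GrossZagier1986_thm_I_7_3)
    (W : WeierstrassCurve ℚ) [W.IsElliptic] [W.IsGloballyMinimal] (hadd : Addv W 3)
    (hr : W.analyticRank = 1)
    (N : ℕ) [NeZero N] (K : Type) [Field K] [NumberField K]
    (Dt : ModularParametrizationData W N) (H : HeegnerDatum N (NumberField.discr K)) (ι : K →+* ℂ)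
    (P : (W.baseChange K).toAffine.Point) (Wd : WeierstrassCurve ℚ) [Wd.IsElliptic] [Wd.IsGloballyMinimal]
    (hN : W.conductorNorm ℤ = N) (hK : IsImaginaryQuadratic K) (hodd : Odd (NumberField.discr K))
    (hd4 : NumberField.discr K < -4) (hHH : SatisfiesHeegnerHypothesis N K)
    (hLd : (W.quadraticTwist (NumberField.discr K : ℚ)).entireLFunction 1 ≠ 0)
    (hP : WeierstrassCurve.Affine.Point.map ι.toRatAlgHom P = heegnerPointComplex Dt H)
    (hC : ∃ C : WeierstrassCurve.VariableChange ℚ, C • W.quadraticTwist (NumberField.discr K : ℚ) = Wd)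
    (hI : Upper.IndexUpperBoundLeAt W 3 K P (padicValNat 3 Dt.c.natAbs))
    (hlow : MissingLowerBoundAt Wd 3) :
    MissingUpperBoundAt W 3 := by
  have h3N : 3 ∣ N := by
    rw [← hN]
    exact (W.dvd_conductorNorm_iff_not_hasGoodReductionAtPrime 3).mpr (not_good_of_addv W 3 hadd)
  have hw : ¬ 3 ∣ Units.torsionOrder K := by
    rw [Literature.NumberTheory.QuadraticFields.Quadratic.torsionOrder_eq_two_of_discr_lt_neg_four hK.1 hd4]
    decide
  exact Upper.missingUpperBoundAt_of_jointUpper_of_lower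
    (Upper.jointUpperBoundAt_of_coStepL_manin hGZ hKo hGZK hmod hGZ73 W 3 N K Dt H ι P Wd hr hN h3N hK
      hodd hw hHH hLd hP hC (by norm_num) hI) hlow

/-! ## §3 The TAM-FREE rows: the socket is Kolyvagin's printed bound -/

/-- **The rank-ONE member's upper half on the TAM-FREE rows: PRINT + the twist's rank-zero lower half.**
Same data as `missingUpperBoundAt_three_of_rankOne_addv_of_upperSocket_of_twistLower`, with the socket
DISCHARGED by Kolyvagin 1990 Thm. A / McCallum 1991 §1 (`hB : Kolyvagin1990_padicValNat_card_sha_le N W K′`: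
`ord₃ #Ш(E/K′) ≤ 2·ord₃ [E(K′):ℤP]`, `p = 3` odd, `ρ̄_{E,3}` onto — NO clause on the reduction at `3`) on the
rows `3 ∤ ∏_ℓ c_ℓ(E)` with a parametrisation of Manin constant prime to `3` (`upper_zero_of_kolyvagin_of_not_
dvd_tamagawa`; the Heegner point is non-torsion by Gross–Zagier since `L′(E/K′,1) = L′(E,1)·L(E^{d},1) ≠ 0`).
[cite: McCallumLMS1991, §1 Theorem (Kolyvagin), p. 296] [cite: GrossLMS1991, §1 Thm. 1.3 (2)]
[cite: GrossZagier1986, Thm. I.(6.3) and (7.3)] [cite: Miller2011LMS, Def. 1.1] -/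
theorem missingUpperBoundAt_three_of_rankOne_addv_tamFree_of_kolyvagin_of_twistLower
    (hGZ : ∀ (N : ℕ) [NeZero N] (W : WeierstrassCurve ℚ) (K : Type) [Field K] [NumberField K],
      gross_zagier N W K)
    (hKo : ∀ (N : ℕ) [NeZero N] (W : WeierstrassCurve ℚ) (K : Type) [Field K] [NumberField K],
      kolyvagin N W K)
    (hGZK : rank_eq_analyticRank_of_analyticRank_le_one) (hmod : hasEntireLFunction_rat)
    (hGZ73 : GrossZagier1986_thm_I_7_3)
    (W : WeierstrassCurve ℚ) [W.IsElliptic] [W.IsGloballyMinimal] (hadd : Addv W 3)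
    (hr : W.analyticRank = 1) (hsurj : W.HasSurjectiveModNGaloisRep 3) (htam : ¬ 3 ∣ W.tamagawaProduct)
    (N : ℕ) [NeZero N] (K : Type) [Field K] [NumberField K]
    (Dt : ModularParametrizationData W N) (H : HeegnerDatum N (NumberField.discr K)) (ι : K →+* ℂ)
    (P : (W.baseChange K).toAffine.Point) (Wd : WeierstrassCurve ℚ) [Wd.IsElliptic] [Wd.IsGloballyMinimal]
    (hB : Kolyvagin1990_padicValNat_card_sha_le N W K)
    (hN : W.conductorNorm ℤ = N) (hK : IsImaginaryQuadratic K) (hodd : Odd (NumberField.discr K))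
    (hd4 : NumberField.discr K < -4) (hHH : SatisfiesHeegnerHypothesis N K)
    (hLd : (W.quadraticTwist (NumberField.discr K : ℚ)).entireLFunction 1 ≠ 0)
    (hP : WeierstrassCurve.Affine.Point.map ι.toRatAlgHom P = heegnerPointComplex Dt H)
    (hc : ¬ (3 : ℤ) ∣ Dt.c)
    (hC : ∃ C : WeierstrassCurve.VariableChange ℚ, C • W.quadraticTwist (NumberField.discr K : ℚ) = Wd)
    (hlow : MissingLowerBoundAt Wd 3) :
    MissingUpperBoundAt W 3 := by
  -- the Heegner point is non-torsion (Gross–Zagier: `L′(E/K′,1) = L′(E,1)·L(E^{(d_{K′})},1) ≠ 0`)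
  have hL0 : W.entireLFunction 1 = 0 := entireLFunction_one_eq_zero_of_analyticRank_eq_one hr
  obtain ⟨-, hderiv⟩ := leadingLCoeff_eq_deriv_of_analyticRank_eq_one hr
  have hLK : LDerivEK W K ≠ 0 := by
    rw [lDerivEK_eq_deriv_mul W K hmod hL0]; exact mul_ne_zero hderiv hLd
  have hnt : ¬ IsOfFinAddOrder P :=
    (lDerivEK_ne_zero_iff_not_isOfFinAddOrder W N K (hGZ N W K) hK hHH ⟨Dt, H, ι, hP⟩).mp hLK
  -- Kolyvagin's printed bound is the socket at slack `0 = v₃(c)`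
  have hup0 : Upper.IndexUpperBoundLeAt W 3 K P 0 :=
    Exact.upper_zero_of_kolyvagin_of_not_dvd_tamagawa hB (by norm_num) hsurj hK hHH Dt H ι hP hnt htam
  have hc0 : padicValNat 3 Dt.c.natAbs = 0 :=
    padicValNat.eq_zero_of_not_dvd fun h ↦ hc (Int.ofNat_dvd_left.mpr h)
  have hI : Upper.IndexUpperBoundLeAt W 3 K P (padicValNat 3 Dt.c.natAbs) := by rw [hc0]; exact hup0
  exact missingUpperBoundAt_three_of_rankOne_addv_of_upperSocket_of_twistLower hGZ hKo hGZK hmod hGZ73 W hadd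
    hr N K Dt H ι P Wd hN hK hodd hd4 hHH hLd hP hC hI hlow

/-! ## §4 X2's conclusion at `(W, V, d)` in orientation (1, 0) -/

/-- **X2 at `(W, V, d)`, orientation (1, 0), from the socket.** For `W` additive at `3` with `r_an(W) = 1` and
its good supersingular rank-zero partner `V` with `surj(9)`: the Kolyvagin-side socket over a split Heegner
datum of `W` + the twist's rank-zero lower half + Perrin-Riou 2003 Prop. 4.8 + the usual published binders
give `JointUpperBoundAt W V 3`, the conclusion of `RamifiedPairUpperBound` at `(W, V, d)`.
[cite: PerrinRiou2003, Prop. 4.8 (p. 162)] [cite: GrossZagier1986, Thm. I.(6.3) and (7.3)]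
[cite: JetchevSkinnerWan2017, §7.4.1] [cite: Miller2011LMS, Def. 1.1] -/
theorem jointUpperBoundAt_rankOne_of_upperSocket_of_twistLower_of_prop48
    (hGZ : ∀ (N : ℕ) [NeZero N] (W : WeierstrassCurve ℚ) (K : Type) [Field K] [NumberField K],
      gross_zagier N W K)
    (hKo : ∀ (N : ℕ) [NeZero N] (W : WeierstrassCurve ℚ) (K : Type) [Field K] [NumberField K],
      kolyvagin N W K)
    (hGZK : rank_eq_analyticRank_of_analyticRank_le_one) (hmod : hasEntireLFunction_rat)
    (hGZ73 : GrossZagier1986_thm_I_7_3) (hPR : PerrinRiou2003.prop48_padicValRat_bsd_rank_zero_le)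
    (W : WeierstrassCurve ℚ) [W.IsElliptic] [W.IsGloballyMinimal]
    (V : WeierstrassCurve ℚ) [V.IsElliptic] [V.IsGloballyMinimal]
    (hadd : Addv W 3) (hss : GoodSS V 3) (hsum : W.analyticRank + V.analyticRank = 1)
    (hr : W.analyticRank = 1) (h9 : V.HasSurjectiveModNGaloisRep 9)
    (N : ℕ) [NeZero N] (K : Type) [Field K] [NumberField K]
    (Dt : ModularParametrizationData W N) (H : HeegnerDatum N (NumberField.discr K)) (ι : K →+* ℂ)
    (P : (W.baseChange K).toAffine.Point) (Wd : WeierstrassCurve ℚ) [Wd.IsElliptic] [Wd.IsGloballyMinimal]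
    (hN : W.conductorNorm ℤ = N) (hK : IsImaginaryQuadratic K) (hodd : Odd (NumberField.discr K))
    (hd4 : NumberField.discr K < -4) (hHH : SatisfiesHeegnerHypothesis N K)
    (hLd : (W.quadraticTwist (NumberField.discr K : ℚ)).entireLFunction 1 ≠ 0)
    (hP : WeierstrassCurve.Affine.Point.map ι.toRatAlgHom P = heegnerPointComplex Dt H)
    (hC : ∃ C : WeierstrassCurve.VariableChange ℚ, C • W.quadraticTwist (NumberField.discr K : ℚ) = Wd)
    (hI : Upper.IndexUpperBoundLeAt W 3 K P (padicValNat 3 Dt.c.natAbs))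
    (hlow : MissingLowerBoundAt Wd 3) :
    Upper.JointUpperBoundAt W V 3 :=
  jointUpperBoundAt_of_analyticRank_eq_one_of_upperW_of_prop48 hPR hGZK hmod W V hss hsum hr h9
    (missingUpperBoundAt_three_of_rankOne_addv_of_upperSocket_of_twistLower hGZ hKo hGZK hmod hGZ73 W hadd hr
      N K Dt H ι P Wd hN hK hodd hd4 hHH hLd hP hC hI hlow)

/-- **X2 at `(W, V, d)`, orientation (1, 0), on the TAM-FREE rows: PRINT + ONE rank-zero lower half.** For
`W` additive at `3`, `r_an(W) = 1`, `ρ̄_{W,3}` onto, `3 ∤ ∏_ℓ c_ℓ(W)`, a split Heegner datum with `3 ∤ c`, and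
the good supersingular rank-zero partner `V` with `surj(9)`: Kolyvagin (print) + Gross–Zagier (print) +
Perrin-Riou 2003 Prop. 4.8 (print) + GZK + modularity + `Typed.MissingLowerBoundAt Wd 3` for the rank-ZERO
twist `Wd ≅ W^{(d_{K′})}` give the conclusion of `RamifiedPairUpperBound` at `(W, V, d)`. The one non-print
input is a LOWER half of a rank-zero curve of the SAME leaf (Gss2 at `3`).
[cite: McCallumLMS1991, §1 Theorem (Kolyvagin), p. 296] [cite: PerrinRiou2003, Prop. 4.8 (p. 162)]
[cite: GrossZagier1986, Thm. I.(6.3) and (7.3)] [cite: Miller2011LMS, Def. 1.1] -/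
theorem jointUpperBoundAt_rankOne_tamFree_of_print_of_twistLower
    (hGZ : ∀ (N : ℕ) [NeZero N] (W : WeierstrassCurve ℚ) (K : Type) [Field K] [NumberField K],
      gross_zagier N W K)
    (hKo : ∀ (N : ℕ) [NeZero N] (W : WeierstrassCurve ℚ) (K : Type) [Field K] [NumberField K],
      kolyvagin N W K)
    (hB : ∀ (N : ℕ) [NeZero N] (W : WeierstrassCurve ℚ) (K : Type) [Field K] [NumberField K],
      Kolyvagin1990_padicValNat_card_sha_le N W K)
    (hGZK : rank_eq_analyticRank_of_analyticRank_le_one) (hmod : hasEntireLFunction_rat)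
    (hGZ73 : GrossZagier1986_thm_I_7_3) (hPR : PerrinRiou2003.prop48_padicValRat_bsd_rank_zero_le)
    (W : WeierstrassCurve ℚ) [W.IsElliptic] [W.IsGloballyMinimal]
    (V : WeierstrassCurve ℚ) [V.IsElliptic] [V.IsGloballyMinimal]
    (hadd : Addv W 3) (hss : GoodSS V 3) (hsum : W.analyticRank + V.analyticRank = 1)
    (hr : W.analyticRank = 1) (hsurj : W.HasSurjectiveModNGaloisRep 3) (htam : ¬ 3 ∣ W.tamagawaProduct)
    (h9 : V.HasSurjectiveModNGaloisRep 9)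
    (N : ℕ) [NeZero N] (K : Type) [Field K] [NumberField K]
    (Dt : ModularParametrizationData W N) (H : HeegnerDatum N (NumberField.discr K)) (ι : K →+* ℂ)
    (P : (W.baseChange K).toAffine.Point) (Wd : WeierstrassCurve ℚ) [Wd.IsElliptic] [Wd.IsGloballyMinimal]
    (hN : W.conductorNorm ℤ = N) (hK : IsImaginaryQuadratic K) (hodd : Odd (NumberField.discr K))
    (hd4 : NumberField.discr K < -4) (hHH : SatisfiesHeegnerHypothesis N K)
    (hLd : (W.quadraticTwist (NumberField.discr K : ℚ)).entireLFunction 1 ≠ 0)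
    (hP : WeierstrassCurve.Affine.Point.map ι.toRatAlgHom P = heegnerPointComplex Dt H)
    (hc : ¬ (3 : ℤ) ∣ Dt.c)
    (hC : ∃ C : WeierstrassCurve.VariableChange ℚ, C • W.quadraticTwist (NumberField.discr K : ℚ) = Wd)
    (hlow : MissingLowerBoundAt Wd 3) :
    Upper.JointUpperBoundAt W V 3 :=
  jointUpperBoundAt_of_analyticRank_eq_one_of_upperW_of_prop48 hPR hGZK hmod W V hss hsum hr h9
    (missingUpperBoundAt_three_of_rankOne_addv_tamFree_of_kolyvagin_of_twistLower hGZ hKo hGZK hmod hGZ73 W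
      hadd hr hsurj htam N K Dt H ι P Wd (hB N W K) hN hK hodd hd4 hHH hLd hP hc hC hlow)

/-! ## §5 The crux BY NAME from three member statements over `ℚ`, split by analytic rank -/

/-- **`RamifiedPairUpperBound` from member upper halves, split by rank** (refines door (ii)
`ramifiedPairUpperBound_of_missingUpperBoundAt`): it suffices that (a) every non-CM globally minimal `W` of
class `(G) ∧ ss` additive at `3` with `r_an(W) = 1`, (b) every such `W` with `r_an(W) = 0`, and (c) every
non-CM globally minimal good-supersingular-at-`3` `V` with `r_an(V) ≤ 1`, satisfy
`Typed.MissingUpperBoundAt · 3`. (b) is print on the Kato-sharp rows (companion file RankZeroMember), (c) is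
print on the `surj(9)` rows (Kobayashi 2013 in rank one; Perrin-Riou 2003 Prop. 4.8 in rank zero), (a) is
§§2–3 above modulo its displayed inputs. Pure bookkeeping. [cite: Miller2011LMS, §1 and Def. 1.1] -/
theorem ramifiedPairUpperBound_of_rankSplit_missingUpperBoundAt
    (hW1 : ∀ (W : WeierstrassCurve ℚ) [W.IsElliptic] [W.IsGloballyMinimal],
      ¬ W.HasCM → Addv W 3 → SubGss W 3 → W.analyticRank = 1 → MissingUpperBoundAt W 3)
    (hW0 : ∀ (W : WeierstrassCurve ℚ) [W.IsElliptic] [W.IsGloballyMinimal],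
      ¬ W.HasCM → Addv W 3 → SubGss W 3 → W.analyticRank = 0 → MissingUpperBoundAt W 3)
    (hV : ∀ (V : WeierstrassCurve ℚ) [V.IsElliptic] [V.IsGloballyMinimal],
      ¬ V.HasCM → GoodSS V 3 → V.analyticRank ≤ 1 → MissingUpperBoundAt V 3) :
    Summit.BirchSwinnertonDyer.BirchSwinnertonDyer.Theses.RamifiedHeegnerPair.RamifiedPairUpperBound :=
  ramifiedPairUpperBound_of_missingUpperBoundAt
    (fun W _ _ hCM hadd hsub hr ↦ by
      rcases Nat.le_one_iff_eq_zero_or_eq_one.mp hr with h | h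
      · exact hW0 W hCM hadd hsub h
      · exact hW1 W hCM hadd hsub h)
    hV

end Summit.BirchSwinnertonDyer.BirchSwinnertonDyer.Theorems.RamifiedPairUpperBound

end
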